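import Summits.CriticalPhenomena.PercolationContinuityZ3.Theorems.Transplant.FKConnectivityAllQPat3Gluing
import HarnessLib

/-!
# Connectivity correlation inequalities for `φ_{w,q}`, every `q > 0` — THE THETA JOIN (Stage S2, part 1a): patterns from bits,
# the join / level-correction tables of three two-terminal pieces in parallel, and the "marks across an interface" lemma

Definitions + theorems file (`--supports stmt-CriticalPhenomena-4575`), census lane `prim-bschramm-census` (gen 36) of the post-continuity programme (LANE 2 bschramm, FK sub-lane);
builds on p205010 (kernel theorem, internal audit signed; external expert review pending).
No named facts, no sorries; standard axioms.  Vocabulary for the THETA configuration of census g34's Lemma Θ₃ (`G = K ∪ Q₁ ∪ Q₂`,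
pieces pairwise meeting inside the corners `{u, v}`, marks `b ∈ K`, `s ∈ Q₁`, `t ∈ Q₂`): `FK.Pat3.ofBits` / `FK.pat3_eq_ofBits`
(a pattern from its three bits), `FK.uvBit` (corners joined in some piece), `FK.Pat3.toU` / `toV` (a mark reaches a corner:
inside its piece, or via the other corner), **`FK.join3`** (pattern on `(b,s,t)`: two marks joined iff both reach `u` or both reach
`v`), **`FK.corr3`** (cycle rank `(#pieces joining u,v) − 1` floored at `0` — census g32 §2.1), `Bool`/`Prop` bookkeeping lemmas,
and `FK.reachable_union_marks`: two marks on different sides of a `{u,v}`-interface are joined iff both reach `u` or both reach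
`v` (from `GZGluing.walk_split`).  The gluing theorems are `…Pat3ThetaGluing.lean`.
[cite: AyyerLinussonRavichandran2025, §7 (p. 22)] [cite: Grimmett2006, §3.8 (pp. 61–62)]
-/

noncomputable section

namespace Summit.CriticalPhenomena.PercolationContinuityZ3.Theorems

namespace FK

open SimpleGraph Literature.Probability.LatticeModels Literature.Probability.Percolation

/-! ### Patterns from bits; the THETA join and level correction -/

/-- A pattern from three connection bits, in the order `(x~y, x~s, y~s)` (inconsistent triples are resolved as `pat3` resolves
them: the third bit is only consulted when the first two are `false`). [folklore] -/
def Pat3.ofBits (bxy bxs bys : Bool) : Pat3 :=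
  if bxy then (if bxs then Pat3.all else Pat3.xy_s) else if bxs then Pat3.xs_y else if bys then Pat3.ys_x else Pat3.sep

/-- The corners-joined bit of a THETA gluing: `u ~ v` in some piece. [folklore] -/
def uvBit (PK P1 P2 : Pat3) : Bool := PK.xy || P1.xy || P2.xy

/-- A mark reaches the corner `u`: inside its piece, or via `v` when the corners are joined. [folklore] -/
def Pat3.toU (P : Pat3) (uv : Bool) : Bool := P.xs || (P.ys && uv)

/-- A mark reaches the corner `v`: inside its piece, or via `u` when the corners are joined. [folklore] -/
def Pat3.toV (P : Pat3) (uv : Bool) : Bool := P.ys || (P.xs && uv)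

/-- **THETA join**: the pattern on the marks `(b, s, t)` of `γ_K ∪ γ₁ ∪ γ₂` from the three pieces' patterns on `(u, v, own mark)`
(`PK` on `(u,v,b)`, `P1` on `(u,v,s)`, `P2` on `(u,v,t)`): two marks are joined iff both reach `u` or both reach `v`
(census g32's gluing law §2.1 for the THETA configuration of g34's Lemma Θ₃). [folklore] -/
def join3 (PK P1 P2 : Pat3) : Pat3 :=
  Pat3.ofBits
    ((PK.toU (uvBit PK P1 P2) && P1.toU (uvBit PK P1 P2)) || (PK.toV (uvBit PK P1 P2) && P1.toV (uvBit PK P1 P2)))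
    ((PK.toU (uvBit PK P1 P2) && P2.toU (uvBit PK P1 P2)) || (PK.toV (uvBit PK P1 P2) && P2.toV (uvBit PK P1 P2)))
    ((P1.toU (uvBit PK P1 P2) && P2.toU (uvBit PK P1 P2)) || (P1.toV (uvBit PK P1 P2) && P2.toV (uvBit PK P1 P2)))

/-- **THETA level correction** (cycle rank of the block–name incidence graph of census g32 §2.1): the number of pieces joining
`u, v`, minus one, floored at zero. [folklore] -/
def corr3 (PK P1 P2 : Pat3) : ℕ :=
  (if PK.xy && P1.xy then 1 else 0) + (if (PK.xy || P1.xy) && P2.xy then 1 else 0)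

open scoped Classical

variable {V : Type*}

/-- `pat3` is `Pat3.ofBits` of the three connection bits. [folklore] -/
theorem pat3_eq_ofBits (γ : Finset (Sym2 V)) (x y s : V) :
    pat3 γ x y s = Pat3.ofBits (conn γ x y) (conn γ x s) (conn γ y s) := by
  have h1 := pat3_xy γ x y s
  have h2 := pat3_xs γ x y s
  have h3 := pat3_ys γ x y s
  cases hP : pat3 γ x y s <;> rw [hP] at h1 h2 h3 <;> simp only [Pat3.xy, Pat3.xs, Pat3.ys] at h1 h2 h3 <;>
    simp [Pat3.ofBits, ← h1, ← h2, ← h3]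

/-- A `Bool`/`Prop` bookkeeping lemma: `((a && b) || (c && d)) = true ↔ (A ∧ B) ∨ (C ∧ D)`. [folklore] -/
theorem bool_or_and_iff {a b c d : Bool} {A B C D : Prop} (ha : a = true ↔ A) (hb : b = true ↔ B) (hc : c = true ↔ C)
    (hd : d = true ↔ D) : ((a && b) || (c && d)) = true ↔ (A ∧ B) ∨ (C ∧ D) := by
  rw [Bool.or_eq_true, Bool.and_eq_true, Bool.and_eq_true, ha, hb, hc, hd]

/-- A `Bool`/`Prop` bookkeeping lemma: `(a || (b && c)) = true ↔ A ∨ (B ∧ C)`. [folklore] -/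
theorem bool_or_and_iff' {a b c : Bool} {A B C : Prop} (ha : a = true ↔ A) (hb : b = true ↔ B) (hc : c = true ↔ C) :
    (a || (b && c)) = true ↔ A ∨ (B ∧ C) := by
  rw [Bool.or_eq_true, Bool.and_eq_true, ha, hb, hc]

/-- A `Bool`/`Prop` bookkeeping lemma: `(a || b || c) = true ↔ A ∨ B ∨ C`. [folklore] -/
theorem bool_or3_iff {a b c : Bool} {A B C : Prop} (ha : a = true ↔ A) (hb : b = true ↔ B) (hc : c = true ↔ C) :
    (a || b || c) = true ↔ A ∨ B ∨ C := by
  simp only [Bool.or_eq_true, ha, hb, hc, or_assoc]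

/-- `toU` read as a proposition. [folklore] -/
theorem Pat3.toU_iff {P : Pat3} {w : Bool} {A B W T : Prop} (h1 : P.xs = true ↔ A) (h2 : P.ys = true ↔ B)
    (hw : w = true ↔ W) (hT : T ↔ A ∨ (W ∧ B)) : P.toU w = true ↔ T := by
  unfold Pat3.toU
  rw [Bool.or_eq_true, Bool.and_eq_true, h1, h2, hw, hT]
  constructor
  · rintro (h | ⟨hb, hw'⟩)
    · exact Or.inl h
    · exact Or.inr ⟨hw', hb⟩
  · rintro (h | ⟨hw', hb⟩)
    · exact Or.inl h
    · exact Or.inr ⟨hb, hw'⟩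

/-- `toV` read as a proposition. [folklore] -/
theorem Pat3.toV_iff {P : Pat3} {w : Bool} {A B W T : Prop} (h1 : P.xs = true ↔ A) (h2 : P.ys = true ↔ B)
    (hw : w = true ↔ W) (hT : T ↔ B ∨ (W ∧ A)) : P.toV w = true ↔ T := by
  unfold Pat3.toV
  rw [Bool.or_eq_true, Bool.and_eq_true, h1, h2, hw, hT]
  constructor
  · rintro (h | ⟨ha, hw'⟩)
    · exact Or.inl h
    · exact Or.inr ⟨hw', ha⟩
  · rintro (h | ⟨hw', ha⟩)
    · exact Or.inl h
    · exact Or.inr ⟨ha, hw'⟩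

section Marks

variable {EA EB : Finset (Sym2 V)} {VA VB : Set V} {u v : V}

/-- **Two marks on different sides of a `{u, v}`-interface are joined iff both reach `u` or both reach `v`** (a walk between
them must cross the interface). [folklore] -/
theorem reachable_union_marks (hA : ∀ e ∈ (↑EA : Set (Sym2 V)), ∀ z ∈ e, z ∈ VA)
    (hB : ∀ e ∈ (↑EB : Set (Sym2 V)), ∀ z ∈ e, z ∈ VB) (hS : VA ∩ VB ⊆ {u, v}) {m m' : V} (hm : m ∉ VB) (hm' : m' ∉ VA)
    (hmu : m ≠ u) (hmv : m ≠ v) (hne : m ≠ m') {γA γB : Finset (Sym2 V)} (gA : γA ⊆ EA) (gB : γB ⊆ EB) :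
    (openGraph (↑(γA ∪ γB) : BondConfig V)).Reachable m m' ↔
      ((openGraph (↑(γA ∪ γB) : BondConfig V)).Reachable m u ∧ (openGraph (↑(γA ∪ γB) : BondConfig V)).Reachable u m') ∨
        ((openGraph (↑(γA ∪ γB) : BondConfig V)).Reachable m v ∧ (openGraph (↑(γA ∪ γB) : BondConfig V)).Reachable v m') := by
  refine ⟨fun h => ?_, ?_⟩
  · have hωA : (↑γA : Set (Sym2 V)) ⊆ ↑EA := Finset.coe_subset.2 gA
    have hωB : (↑γB : Set (Sym2 V)) ⊆ ↑EB := Finset.coe_subset.2 gB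
    rw [Finset.coe_union] at h ⊢
    obtain ⟨p⟩ := h
    have hS' : VA ∩ VB ⊆ ({u, v, m'} : Set V) := by
      intro z hz
      rcases hS hz with h | h
      · exact Or.inl h
      · exact Or.inr (Or.inl h)
    obtain ⟨s', hs'S, hside, hchain⟩ := GZGluing.walk_split hA hB hS' hωA hωB p (by simp)
    -- the first segment lies in `γA` and ends at `u` or `v`
    have hfirst : (openGraph (↑γA : BondConfig V)).Reachable m s' ∧ (s' = u ∨ s' = v) := by
      rcases hside with h | h
      · refine ⟨h, ?_⟩
        rcases hs'S with h' | h' | h'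
        · exact Or.inl h'
        · exact Or.inr h'
        · exfalso
          rw [Set.mem_singleton_iff] at h'
          subst h'
          exact hm' (GZGluing.mem_of_reachable_ne hA hωA h.symm (Ne.symm hne))
      · exfalso
        by_cases hms : m = s'
        · subst hms
          rcases hs'S with h' | h' | h'
          · exact hmu h'
          · exact hmv h'
          · exact hne h'
        · exact hm (GZGluing.mem_of_reachable_ne hB hωB h hms)
    -- the hop chain from `s'` to `m'` is a union walk
    have hA' : ∀ a c, a ∈ ({z | (openGraph ((↑γA : Set (Sym2 V)) ∪ ↑γB)).Reachable s' z} : Set V) →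
        (a ∈ ({u, v, m'} : Set V) ∧ c ∈ ({u, v, m'} : Set V) ∧
          ((openGraph (↑γA : BondConfig V)).Reachable a c ∨ (openGraph (↑γB : BondConfig V)).Reachable a c)) →
        c ∈ ({z | (openGraph ((↑γA : Set (Sym2 V)) ∪ ↑γB)).Reachable s' z} : Set V) :=
      fun a c ha hac => Reachable.trans ha (GZGluing.reachable_union_of_side hac.2.2)
    have hrest : (openGraph ((↑γA : Set (Sym2 V)) ∪ ↑γB)).Reachable s' m' :=
      GZGluing.reflTransGen_mem hA' hchain (Reachable.refl _)
    have hm_s' : (openGraph ((↑γA : Set (Sym2 V)) ∪ ↑γB)).Reachable m s' :=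
      GZGluing.reachable_union_of_side (Or.inl hfirst.1)
    rcases hfirst.2 with h' | h'
    · subst h'; exact Or.inl ⟨hm_s', hrest⟩
    · subst h'; exact Or.inr ⟨hm_s', hrest⟩
  · rintro (⟨h1, h2⟩ | ⟨h1, h2⟩)
    · exact h1.trans h2
    · exact h1.trans h2

end Marks

section Helpers

variable {EK E₁ E₂ : Finset (Sym2 V)} {VK V₁ V₂ : Set V} {u v : V}

/-- Edges of a union lie on the union of the vertex sets. [folklore] -/
theorem edges_union_verts (hK : ∀ e ∈ (↑EK : Set (Sym2 V)), ∀ z ∈ e, z ∈ VK)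
    (h₁ : ∀ e ∈ (↑E₁ : Set (Sym2 V)), ∀ z ∈ e, z ∈ V₁) :
    ∀ e ∈ (↑(EK ∪ E₁) : Set (Sym2 V)), ∀ z ∈ e, z ∈ VK ∪ V₁ := by
  intro e he z hz
  rw [Finset.coe_union] at he
  rcases he with he | he
  · exact Or.inl (hK e he z hz)
  · exact Or.inr (h₁ e he z hz)

/-- Interface of `K ∪ Q₁` with `Q₂` inside `{u, v}`. [folklore] -/
theorem union_inter_subset_pair' (hK2 : VK ∩ V₂ ⊆ ({u, v} : Set V)) (h12 : V₁ ∩ V₂ ⊆ ({u, v} : Set V)) :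
    (VK ∪ V₁) ∩ V₂ ⊆ ({u, v} : Set V) := by
  rintro z ⟨hz | hz, hz2⟩
  · exact hK2 ⟨hz, hz2⟩
  · exact h12 ⟨hz, hz2⟩

end Helpers

/-- A `Prop`-`if` equals a `Bool`-`if` when the proposition is the bit. [folklore] -/
theorem ite_prop_eq_ite_bool {p : Prop} {d : Decidable p} {bb : Bool} (h : bb = true ↔ p) :
    @ite ℕ p d 1 0 = (if bb then 1 else 0) := by
  by_cases hp : p
  · rw [if_pos hp, if_pos (h.2 hp)]
  · have hb : bb = false := by
      cases hbb : bb
      · rfl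
      · exact absurd (h.1 hbb) hp
    rw [if_neg hp, hb]
    rfl

end FK

end Summit.CriticalPhenomena.PercolationContinuityZ3.Theorems

end
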